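import Literature.Analysis.FluidPDE.ConstantinSmallViscosityWordEnergy
import Literature.Analysis.FluidPDE.ConstantinDifferenceEnergy
import Literature.Analysis.FluidPDE.ConstantinSmallViscosityReduction
import HarnessLib

/-!
# Constantin's small-viscosity comparison theorem: the a priori estimate on a slab and the
# discharge `constantin_small_viscosity_holds`

Analysis/FluidPDE proof file (theorems only, no definitions, no named facts): the discharge of
the named fact `Literature.Analysis.FluidPDE.constantin_small_viscosity`
(`ConstantinSmallViscosity.lean`; P. Constantin, *Note on loss of regularity for solutions of the
3-D incompressible Euler and related equations*, Comm. Math. Phys. 104 (1986) 311–326, §1,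
**Thm. 1.1**: as long as the Euler solution is smooth on `[0, T]`, the Navier–Stokes solutions
with the same datum and viscosity `0 < ν ≤ ν₀` are smooth on `[0, T]`, and
`sup_{[0,T]} ‖u − v‖ₘ ≤ Cν`).

The proof assembled here is Constantin's (held text `paper:doi-10-1007-bf01211598`, pp. 4–7):

1. **(1.7)–(1.10), the `H^m` energy inequality for `w = u − v`**, in the tree's coordinate
   form: at each interior time and for each word `α`, the tree's slice inequality
   `constantin_slice_word_pairing_le` (`ConstantinSmallViscositySlice`) with the trilinear terms
   closed by the Sobolev imbedding at level `k = m + 1 ≥ 4` (`slice_word_le_energy_form`,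
   `ConstantinSmallViscosityWordEnergy`); here (`exists_slice_constants`) it is instantiated on
   the slab — both pressures are normalised at interior times by Tao's Lemma 4.1 (i), proved in
   the tree for `ν ≥ 0` (`pressure_sub_pressurePotential_eq`), all sup and `L²` bounds of the
   Euler solution come from its Beale–Kato–Majda class, the cut-off is `χ_R` — and summed over
   the words of length `≤ k`, giving the slice hypothesis of `energy_le_of_slice` with constants
   `A, B, K'` depending only on the Euler solution on `[0, T]` and on `k`;
2. **(1.11)–(1.18), time integration and the ODE Lemma 1.3**: `energy_le_of_slice`
   (`ConstantinDifferenceEnergy`, using `constantin_energy_bootstrap` of `ConstantinODELemma`)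
   gives `∑_{n ≤ k}∫|∇ⁿ(u(t) − U(t))|² ≤ K₀ν²` on every slab `[0, S] ⊆ [0, T]` on which a
   Beale–Kato–Majda-class Navier–Stokes solution from the Euler datum exists, for
   `ν ≤ ν₁ = (4(BT√K₀ + 1))⁻¹` (`constantin_apriori`, Constantin's (1.18));
3. **continuation** ("we omit further details", p. 7): the restart induction in Tao's class,
   `constantin_small_viscosity_of_apriori` (`ConstantinSmallViscosityReduction`, local theory
   `tao2011_smooth_local_existence_holds`).

## Mathlib / tree search

Everything used is cited in place. `lean search 'constantin_small_viscosity_holds'`: absent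
before this file.

## References

* P. Constantin, Comm. Math. Phys. 104 (1986) 311–326, §1, Thm. 1.1, (1.7)–(1.18), Lemma 1.3.
  [Constantin1986]
* T. Tao, Anal. PDE 6 (2013) = arXiv:1108.1165, Lemma 4.1 (i), Thm. 5.4. [Tao2011]
-/

noncomputable section

open MeasureTheory Set Function Filter
open _root_.Topology
open scoped ENNReal NNReal ContDiff BigOperators

namespace Literature.Analysis.FluidPDE

/-! ## The bridge between the two forms of the pairing -/

section Bridge

variable {S ν : ℝ} {u U : ℝ → EuclideanSpace ℝ (Fin 3) → EuclideanSpace ℝ (Fin 3)}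
  {p P : ℝ → EuclideanSpace ℝ (Fin 3) → ℝ}

/-- **The time derivative of `∂^α(uᵢ − Uᵢ)` is the `∂^α`-derivative of the difference of the
two momentum right-hand sides** (mixed partials commute on the closed slab,
`timeDerivWithin_ipderiv_slice`, and `IsClassicalNSSolutionOn.timeDerivWithin_comp_eq` for both
solutions, `ν` and `0`). [folklore] -/
theorem timeDerivWithin_ipderiv_sub_eq_rhs (hu : IsClassicalNSSolutionOn (Icc 0 S) ν 0 u p)
    (hU : IsClassicalNSSolutionOn (Icc 0 S) 0 0 U P) (hS : 0 < S) {t : ℝ} (ht : t ∈ Icc 0 S)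
    (x : EuclideanSpace ℝ (Fin 3)) {n : ℕ} (α : Fin n → Fin 3) (i : Fin 3) :
    FluidPDE.timeDerivWithin (Icc 0 S) (fun s y => ipderiv α (fun z => u s z i - U s z i) y) t x =
      ipderiv α (fun y => ν * ∑ j, pderiv j (pderiv j fun z => u t z i) y - pderiv i (p t) y -
          ∑ j, u t y j * pderiv j (fun z => u t z i) y) x -
        ipderiv α (fun y => 0 * ∑ j, pderiv j (pderiv j fun z => U t z i) y - pderiv i (P t) y -
          ∑ j, U t y j * pderiv j (fun z => U t z i) y) x := by
  have hUq := uniqueDiffOn_Icc hS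
  have hcl := Icc_subset_closure_interior hS
  have hjoint : IsSmoothSpaceTimeOn (Icc 0 S) (fun s y => u s y i - U s y i) :=
    (hu.isSmoothSpaceTimeOn_comp i).sub (hU.isSmoothSpaceTimeOn_comp i)
  have hTfun : FluidPDE.timeDerivWithin (Icc 0 S) (fun s y => u s y i - U s y i) t = fun y =>
      FluidPDE.timeDerivWithin (Icc 0 S) (fun s y => u s y i) t y -
        FluidPDE.timeDerivWithin (Icc 0 S) (fun s y => U s y i) t y :=
    funext fun y => (hu.isSmoothSpaceTimeOn_comp i).timeDerivWithin_fun_sub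
      (hU.isSmoothSpaceTimeOn_comp i) hUq ht y
  have cTu : ContDiff ℝ ∞ (FluidPDE.timeDerivWithin (Icc 0 S) (fun s y => u s y i) t) :=
    ((hu.isSmoothSpaceTimeOn_comp i).timeDerivWithin hUq).contDiff_slice ht
  have cTU : ContDiff ℝ ∞ (FluidPDE.timeDerivWithin (Icc 0 S) (fun s y => U s y i) t) :=
    ((hU.isSmoothSpaceTimeOn_comp i).timeDerivWithin hUq).contDiff_slice ht
  rw [hjoint.timeDerivWithin_ipderiv_slice hUq hcl α ht x, hTfun]
  have e := ipderiv_sub cTu cTU α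
  simp only at e
  rw [e]
  simp only
  rw [hu.timeDerivWithin_comp_eq hUq ht i, hU.timeDerivWithin_comp_eq hUq ht i]

end Bridge

/-! ## The slice inequality on a slab, with constants depending only on the Euler solution -/

section Slab

/-- `(a − b)² ≤ 2a² + 2b²`. [folklore] -/
theorem real_sub_sq_le_two_mul_sq_add (a b : ℝ) : (a - b) ^ 2 ≤ 2 * a ^ 2 + 2 * b ^ 2 := by
  linarith only [sq_nonneg (a + b)]

-- one long assembly proof with many abbreviations; the default budget is exceeded by a small factor
set_option maxHeartbeats 1600000 in
/-- **The slice inequality on a slab (Constantin 1986, (1.10), all words of length `≤ k`).**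
Let `(U, P)` be a classical Euler solution on `[0, T] × ℝ³` in the Beale–Kato–Majda class and
`k ≥ 4`. There are `A, B ≥ 0`, `K' > 0`, depending only on `U` on `[0, T]` and on `k`, such that
for every viscosity `ν > 0`, every slab `[0, S] ⊆ [0, T]` and every classical Navier–Stokes
solution `(u, p)` on `[0, S] × ℝ³` in the Beale–Kato–Majda class there is `K` (depending on the
slab and on `u`) with: for all `R ≥ 1` and all interior times `t`,
`2∑_{n ≤ k}∑ᵢ∑_{|α| = n} ∫ χ_R ∂ₜ(∂^α wᵢ) ∂^α wᵢ ≤ A E + B E√E + ν K' √E + K/R`,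
`w = u − U`, `E = E(t) = ∑_{n ≤ k}∫|∇ⁿw(t)|²` — the hypothesis of `energy_le_of_slice`. Both
pressures are normalised at interior times (`pressure_sub_pressurePotential_eq`, `ν ≥ 0`), the
slice inequality for each word is `slice_word_le_energy_form`, and the words are summed.
[cite: Constantin1986, §1 (1.7)-(1.10)] -/
theorem exists_slice_constants {T : ℝ}
    {U : ℝ → EuclideanSpace ℝ (Fin 3) → EuclideanSpace ℝ (Fin 3)} {P : ℝ → EuclideanSpace ℝ (Fin 3) → ℝ}
    (hE : IsClassicalEulerSolutionOn (Icc 0 T) 0 U P) (hB : HasBoundedSobolevNormsOn (Icc 0 T) U)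
    {k : ℕ} (hk : 4 ≤ k) :
    ∃ A B K' : ℝ, 0 ≤ A ∧ 0 ≤ B ∧ 0 < K' ∧ ∀ ν : ℝ, 0 < ν → ∀ S : ℝ, 0 < S → S ≤ T →
      ∀ (u : ℝ → EuclideanSpace ℝ (Fin 3) → EuclideanSpace ℝ (Fin 3)) (p : ℝ → EuclideanSpace ℝ (Fin 3) → ℝ),
        IsClassicalNSSolutionOn (Icc 0 S) ν 0 u p → HasBoundedSobolevNormsOn (Icc 0 S) u →
        ∃ Kerr : ℝ, ∀ R : ℝ, 1 ≤ R → ∀ t ∈ Ioo 0 S,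
          2 * ∑ n ∈ Finset.range (k + 1), ∑ i, ∑ α : Fin n → Fin 3, ∫ x, cutoff R x *
              (FluidPDE.timeDerivWithin (Icc 0 S) (fun s y => ipderiv α (fun z => u s z i - U s z i) y) t x *
                ipderiv α (fun z => u t z i - U t z i) x) ≤
            (A * (∑ n ∈ Finset.range (k + 1), ∫ x, levelSq n (u t - U t) x) +
              B * ((∑ n ∈ Finset.range (k + 1), ∫ x, levelSq n (u t - U t) x) *
                Real.sqrt (∑ n ∈ Finset.range (k + 1), ∫ x, levelSq n (u t - U t) x)) +
              ν * K' * Real.sqrt (∑ n ∈ Finset.range (k + 1), ∫ x, levelSq n (u t - U t) x)) +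
            Kerr / R := by
  have hUsm : ∀ t ∈ Icc 0 T, ContDiff ℝ ∞ (U t) := fun t ht => hE.contDiff_velocity ht
  -- bounds of the Euler solution: `L²` levels, sup levels
  have hlev := fun m => levelSq_bounds_of_hasBoundedSobolevNormsOn hUsm hB m
  have h1 : ∀ m, ∃ I : ℝ, ∀ t ∈ Icc 0 T, Integrable (levelSq m (U t)) ∧ ∫ x, levelSq m (U t) x ≤ I :=
    fun m => (hlev m).1
  have h2 : ∀ m, ∃ Pm : ℝ, 0 ≤ Pm ∧ ∀ t ∈ Icc 0 T, ∀ x, levelSq m (U t) x ≤ Pm := fun m => (hlev m).2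
  choose IU hIU using h1
  choose PU hPU0 hPU using h2
  set Bb : ℝ := ∑ c ∈ Finset.range (k + 2), Real.sqrt (PU c) with hBb
  have hBb0 : 0 ≤ Bb := Finset.sum_nonneg fun c _ => Real.sqrt_nonneg _
  have hBbc : ∀ c ≤ k + 1, ∀ t ∈ Icc 0 T, ∀ (i : Fin 3) (x : EuclideanSpace ℝ (Fin 3)),
      dnorm c (fun y => U t y i) x ≤ Bb := by
    intro c hc t ht i x
    calc dnorm c (fun y => U t y i) x ≤ Real.sqrt (levelSq c (U t) x) := dnorm_comp_le_sqrt_levelSq _ c i x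
      _ ≤ Real.sqrt (PU c) := Real.sqrt_le_sqrt (hPU c t ht x)
      _ ≤ Bb := Finset.single_le_sum (f := fun c => Real.sqrt (PU c)) (fun _ _ => Real.sqrt_nonneg _)
          (Finset.mem_range.2 (by omega))
  set IUmax : ℝ := ∑ m ∈ Finset.range (k + 3), |IU m| with hIUmax
  have hIUmax0 : 0 ≤ IUmax := Finset.sum_nonneg fun m _ => abs_nonneg _
  have hIUle : ∀ m ≤ k + 2, IU m ≤ IUmax := fun m hm =>
    (le_abs_self _).trans (Finset.single_le_sum (f := fun m => |IU m|) (fun _ _ => abs_nonneg _)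
      (Finset.mem_range.2 (by omega)))
  -- the Sobolev constant and the cut-off constants
  obtain ⟨Cemb, hCemb0, hCemb⟩ := exists_dnormSq_le_energy k
  obtain ⟨A₁, hA₁0, hA₁⟩ := exists_abs_pderiv_cutoff_le_div (ι := Fin 3)
  obtain ⟨A₂, hA₂0, hA₂⟩ := exists_dnorm_cutoff_le_of_le (ι := Fin 3) (k + 1)
  set Aχ : ℝ := A₁ + A₂ with hAχ
  have hAχ0 : 0 ≤ Aχ := add_nonneg hA₁0 hA₂0
  -- the constants
  set N : ℝ := 2 * ((k + 1) * 3 ^ k) with hN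
  have hN0 : 0 ≤ N := by rw [hN]; positivity
  set A : ℝ := N * (2 ^ k * 9 * Bb * (k + 1) ^ 2) with hA
  set B : ℝ := N * (2 ^ k * (9 * k * Real.sqrt Cemb)) with hBdef
  set K' : ℝ := N * (9 * Real.sqrt IUmax) + 1 with hK'
  refine ⟨A, B, K', by rw [hA]; positivity, by rw [hBdef]; positivity, by rw [hK']; positivity,
    fun ν hν S hS hST u p hu hbu => ?_⟩
  -- the slab data
  have hSI : Icc 0 S ⊆ Icc 0 T := Icc_subset_Icc le_rfl hST
  have hU : IsClassicalNSSolutionOn (Icc 0 S) 0 0 U P := hE.mono hSI (uniqueDiffOn_Icc hS)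
  have hbU : HasBoundedSobolevNormsOn (Icc 0 S) U := hB.mono hSI
  have husm : ∀ t ∈ Icc 0 S, ContDiff ℝ ∞ (u t) := fun t ht => hu.contDiff_velocity ht
  -- level integrals of the difference on the slab
  have hw := fun m => levelSq_sub_bounds hu hU hbu hbU m
  choose Iw hIw0 hIw using hw
  set Iws : ℝ := ∑ m ∈ Finset.range (2 * k + 2), Iw m with hIws
  have hIws0 : 0 ≤ Iws := Finset.sum_nonneg fun m _ => hIw0 m
  have hIwle : ∀ m ≤ 2 * k + 1, Iw m ≤ Iws := fun m hm =>
    Finset.single_le_sum (f := Iw) (fun m _ => hIw0 m) (Finset.mem_range.2 (by omega))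
  -- energies and sup of `u` and `U` at order zero, and the normalised pressures
  obtain ⟨⟨I0u, hI0u⟩, -⟩ := levelSq_bounds_of_hasBoundedSobolevNormsOn husm hbu 0
  obtain ⟨B0u, hB0u0, hB0u⟩ := exists_forall_norm_iteratedFDeriv_le_bkmClass husm hbu 0
  obtain ⟨⟨I0U, hI0U⟩, -⟩ := levelSq_bounds_of_hasBoundedSobolevNormsOn (fun t ht => hUsm t (hSI ht)) hbU 0
  obtain ⟨B0U, hB0U0, hB0U⟩ := exists_forall_norm_iteratedFDeriv_le_bkmClass (fun t ht => hUsm t (hSI ht)) hbU 0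
  have huB : ∀ t ∈ Icc 0 S, ∀ x, ‖u t x‖ ≤ B0u := fun t ht x => by
    have := hB0u t ht x; rwa [norm_iteratedFDeriv_zero] at this
  have hUB : ∀ t ∈ Icc 0 S, ∀ x, ‖U t x‖ ≤ B0U := fun t ht x => by
    have := hB0U t ht x; rwa [norm_iteratedFDeriv_zero] at this
  have hEu_int : ∀ t ∈ Icc 0 S, Integrable fun x => ‖u t x‖ ^ 2 := fun t ht =>
    (hI0u t ht).1.congr (Eventually.of_forall fun x => levelSq_zero_eq_norm_sq (u t) x)
  have hEu_le : ∀ t ∈ Icc 0 S, ∫ x, ‖u t x‖ ^ 2 ≤ I0u := fun t ht => by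
    rw [← integral_congr_ae (Eventually.of_forall fun x => levelSq_zero_eq_norm_sq (u t) x)]
    exact (hI0u t ht).2
  have hEU_int : ∀ t ∈ Icc 0 S, Integrable fun x => ‖U t x‖ ^ 2 := fun t ht =>
    (hI0U t ht).1.congr (Eventually.of_forall fun x => levelSq_zero_eq_norm_sq (U t) x)
  have hEU_le : ∀ t ∈ Icc 0 S, ∫ x, ‖U t x‖ ^ 2 ≤ I0U := fun t ht => by
    rw [← integral_congr_ae (Eventually.of_forall fun x => levelSq_zero_eq_norm_sq (U t) x)]
    exact (hI0U t ht).2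
  have h0S : (0 : ℝ) ∈ Icc 0 S := ⟨le_rfl, hS.le⟩
  have hI0u0 : 0 ≤ I0u := (integral_nonneg fun x => sq_nonneg _).trans (hEu_le 0 h0S)
  have hI0U0 : 0 ≤ I0U := (integral_nonneg fun x => sq_nonneg _).trans (hEU_le 0 h0S)
  -- normalised pressures at interior times
  have hQu : ∀ t ∈ Ioo 0 S, ∀ x,
      p t x = normalisedPressure (u t) x + (p t 0 - pressurePotential (u t) 0) := by
    intro t ht x
    have ht' : t ∈ Icc 0 S := Ioo_subset_Icc_self ht
    have h1 := pressure_sub_pressurePotential_eq hν.le hu hI0u0 hEu_int hEu_le ht x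
    rw [normalisedPressure_eq_pressurePotential ((husm t ht').of_le (by norm_cast)) (hEu_int t ht') x]
    linarith
  have hQU : ∀ t ∈ Ioo 0 S, ∀ x,
      P t x = normalisedPressure (U t) x + (P t 0 - pressurePotential (U t) 0) := by
    intro t ht x
    have ht' : t ∈ Icc 0 S := Ioo_subset_Icc_self ht
    have h1 := pressure_sub_pressurePotential_eq le_rfl hU hI0U0 hEU_int hEU_le ht x
    rw [normalisedPressure_eq_pressurePotential ((hUsm t (hSI ht')).of_le (by norm_cast)) (hEU_int t ht') x]
    linarith
  set Q0u : ℝ := (27 * regLaplacianMass) ^ 2 * (B0u ^ 2 * I0u) with hQ0u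
  set Q0U : ℝ := (27 * regLaplacianMass) ^ 2 * (B0U ^ 2 * I0U) with hQ0U
  have hQuL2 : ∀ t ∈ Icc 0 S, Integrable (fun x => normalisedPressure (u t) x ^ 2) ∧
      ∫ x, normalisedPressure (u t) x ^ 2 ≤ Q0u := fun t ht =>
    integral_normalisedPressure_sq_le_of_bound (husm t ht) (hEu_int t ht) (hEu_le t ht) (huB t ht)
  have hQUL2 : ∀ t ∈ Icc 0 S, Integrable (fun x => normalisedPressure (U t) x ^ 2) ∧
      ∫ x, normalisedPressure (U t) x ^ 2 ≤ Q0U := fun t ht =>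
    integral_normalisedPressure_sq_le_of_bound (hUsm t (hSI ht)) (hEU_int t ht) (hEU_le t ht) (hUB t ht)
  have hQ0u0 : 0 ≤ Q0u := by rw [hQ0u]; positivity
  have hQ0U0 : 0 ≤ Q0U := by rw [hQ0U]; positivity
  set Qs : ℝ := Real.sqrt (2 * Q0u + 2 * Q0U) with hQs
  have hQs0 : 0 ≤ Qs := Real.sqrt_nonneg _
  -- the cutoff error constant
  set Xs : ℝ := 9 * B0u * Iws / 2 + 9 * ν * Iws + 2 ^ k * Qs * (3 * (k + 1) * Real.sqrt Iws) with hXs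
  have hk1 : (0 : ℝ) ≤ k + 1 := by positivity
  have hXs0 : 0 ≤ Xs := by
    rw [hXs]
    exact add_nonneg (add_nonneg (div_nonneg (mul_nonneg (mul_nonneg (by norm_num) hB0u0) hIws0) (by norm_num))
      (mul_nonneg (mul_nonneg (by norm_num) hν.le) hIws0))
      (mul_nonneg (mul_nonneg (pow_nonneg (by norm_num) k) hQs0)
        (mul_nonneg (mul_nonneg (by norm_num) hk1) (Real.sqrt_nonneg _)))
  refine ⟨N * (Aχ * Xs), fun R hR t ht => ?_⟩
  have hR0 : 0 < R := one_pos.trans_le hR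
  have ht' : t ∈ Icc 0 S := Ioo_subset_Icc_self ht
  -- the players at time `t`
  have ha : ContDiff ℝ ∞ (u t) := husm t ht'
  have hb : ContDiff ℝ ∞ (U t) := hUsm t (hSI ht')
  have hdiva : ∀ x, ∑ j, pderiv j (fun y => u t y j) x = 0 := fun x => hu.sum_pderiv_comp_eq_zero ht' x
  have hdivb : ∀ x, ∑ j, pderiv j (fun y => U t y j) x = 0 := fun x => hU.sum_pderiv_comp_eq_zero ht' x
  have hp₁ : ContDiff ℝ ∞ (p t) := hu.contDiff_pressure ht'
  have hp₂ : ContDiff ℝ ∞ (P t) := hU.contDiff_pressure ht'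
  set Q : EuclideanSpace ℝ (Fin 3) → ℝ := fun x => normalisedPressure (u t) x - normalisedPressure (U t) x with hQdef
  have hrQ : ∀ x, p t x - P t x = Q x + ((p t 0 - pressurePotential (u t) 0) - (P t 0 - pressurePotential (U t) 0)) := by
    intro x
    simp only [hQdef]
    rw [hQu t ht x, hQU t ht x]
    ring
  have hmu : MemLp (normalisedPressure (u t)) 2 volume :=
    (memLp_two_iff_integrable_sq (aestronglyMeasurable_normalisedPressure_of_integrable ha (hEu_int t ht'))).2
      (hQuL2 t ht').1
  have hmU : MemLp (normalisedPressure (U t)) 2 volume :=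
    (memLp_two_iff_integrable_sq (aestronglyMeasurable_normalisedPressure_of_integrable hb (hEU_int t ht'))).2
      (hQUL2 t ht').1
  have hQmem : MemLp Q 2 volume := hmu.sub hmU
  have hQs_le : Real.sqrt (∫ x, Q x ^ 2) ≤ Qs := by
    refine Real.sqrt_le_sqrt ?_
    have hdom : Integrable fun x => 2 * normalisedPressure (u t) x ^ 2 + 2 * normalisedPressure (U t) x ^ 2 :=
      ((hQuL2 t ht').1.const_mul 2).add ((hQUL2 t ht').1.const_mul 2)
    calc ∫ x, Q x ^ 2 ≤ ∫ x, (2 * normalisedPressure (u t) x ^ 2 + 2 * normalisedPressure (U t) x ^ 2) :=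
          integral_mono_of_nonneg (Eventually.of_forall fun x => sq_nonneg _) hdom
            (Eventually.of_forall fun x => by
              simp only [hQdef]
              exact real_sub_sq_le_two_mul_sq_add _ _)
      _ = 2 * (∫ x, normalisedPressure (u t) x ^ 2) + 2 * ∫ x, normalisedPressure (U t) x ^ 2 := by
          rw [integral_add ((hQuL2 t ht').1.const_mul 2) ((hQUL2 t ht').1.const_mul 2), integral_const_mul,
            integral_const_mul]
      _ ≤ 2 * Q0u + 2 * Q0U := by
          have h1 := (hQuL2 t ht').2
          have h2 := (hQUL2 t ht').2
          linarith only [h1, h2]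
  -- the cutoff
  have hχ : ContDiff ℝ ∞ (cutoff (E := EuclideanSpace ℝ (Fin 3)) R) := contDiff_cutoff R
  have hχc : HasCompactSupport (cutoff (E := EuclideanSpace ℝ (Fin 3)) R) := hasCompactSupport_cutoff hR0
  have hAR1 : ∀ (j : Fin 3) (x : EuclideanSpace ℝ (Fin 3)), |pderiv j (cutoff R) x| ≤ Aχ / R := fun j x =>
    (hA₁ R hR j x).trans (div_le_div_of_nonneg_right (by rw [hAχ]; linarith) hR0.le)
  have hARk : ∀ c, 1 ≤ c → c ≤ k + 1 → ∀ x : EuclideanSpace ℝ (Fin 3), dnorm c (cutoff R) x ≤ Aχ / R :=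
    fun c hc1 hck x => (hA₂ R hR c hc1 hck x).trans (div_le_div_of_nonneg_right (by rw [hAχ]; linarith) hR0.le)
  -- the difference family and its energy
  have hIall : ∀ m, Integrable (fun x => ∑ i, dnormSq m (fun z => u t z i - U t z i) x)
      (volume : Measure (EuclideanSpace ℝ (Fin 3))) := fun m =>
    ((hIw m t ht').1).congr (Eventually.of_forall fun x => levelSq_sub_eq_sum (u t) (U t) m x)
  have hLeq : ∀ m, ∫ x, ∑ i, dnormSq m (fun z => u t z i - U t z i) x = ∫ x, levelSq m (u t - U t) x := fun m =>
    integral_congr_ae (Eventually.of_forall fun x => (levelSq_sub_eq_sum (u t) (U t) m x).symm)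
  set Et : ℝ := ∑ n ∈ Finset.range (k + 1), ∫ x, levelSq n (u t - U t) x with hEt
  have hL0 : ∀ m, 0 ≤ ∫ x, levelSq m (u t - U t) x := fun m => integral_nonneg fun x => levelSq_nonneg m _ x
  have hEt0 : 0 ≤ Et := Finset.sum_nonneg fun n _ => hL0 n
  have hEle : ∀ m ≤ k, ∫ x, ∑ i, dnormSq m (fun z => u t z i - U t z i) x ≤ Et := fun m hm => by
    rw [hLeq m]
    exact Finset.single_le_sum (f := fun n => ∫ x, levelSq n (u t - U t) x) (fun n _ => hL0 n)
      (Finset.mem_range.2 (by omega))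
  have hIwt : ∀ m ≤ 2 * k + 1, ∫ x, ∑ i, dnormSq m (fun z => u t z i - U t z i) x ≤ Iws := fun m hm => by
    rw [hLeq m]
    exact ((hIw m t ht').2).trans (hIwle m hm)
  have hwc : ∀ i, ContDiff ℝ ∞ fun z => u t z i - U t z i := fun i =>
    (contDiff_comp_of_contDiff ha i).sub (contDiff_comp_of_contDiff hb i)
  have hsup : ∀ c : ℕ, c + 2 ≤ k → ∀ (i : Fin 3) (x : EuclideanSpace ℝ (Fin 3)),
      dnormSq c (fun z => u t z i - U t z i) x ≤ Cemb * Et :=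
    hCemb (fun i z => u t z i - U t z i) hwc Et hEt0 (fun m hm => ⟨hIall m, hEle m hm⟩)
  -- the per-word bound, uniform in the word and in `n ≤ k`
  have hword : ∀ n ≤ k, ∀ α : Fin n → Fin 3,
      ∑ i, ∫ x, cutoff R x *
        (FluidPDE.timeDerivWithin (Icc 0 S) (fun s y => ipderiv α (fun z => u s z i - U s z i) y) t x *
          ipderiv α (fun z => u t z i - U t z i) x) ≤
      Aχ * Xs / R + ν * (9 * Real.sqrt IUmax) * Real.sqrt Et + 2 ^ k * 9 * Bb * (k + 1) ^ 2 * Et +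
        2 ^ k * (9 * k * (Real.sqrt Cemb * (Et * Real.sqrt Et))) := by
    intro n hn α
    have hIb : Integrable (fun x => ∑ i, dnormSq (n + 2) (fun y => U t y i) x)
        (volume : Measure (EuclideanSpace ℝ (Fin 3))) := (hIU (n + 2) t (hSI ht')).1
    have hIbU : ∫ x, ∑ i, dnormSq (n + 2) (fun y => U t y i) x ≤ IUmax :=
      ((hIU (n + 2) t (hSI ht')).2).trans (hIUle (n + 2) (by omega))
    have h := slice_word_le_energy_form ha hb hdiva hdivb hp₁ hp₂ hrQ hQmem hQs0 hQs_le hχ hχc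
      (cutoff_nonneg R) (cutoff_le_one R) hk hn α hIall hEt0 hEle hIws0 hIwt hCemb0 hsup hIb hIbU hν.le
      hB0u0 (fun x j => by
        have h1 : |u t x j| ≤ ‖u t x‖ := by simpa using PiLp.norm_apply_le (u t x) j
        exact h1.trans (huB t ht' x))
      hBb0 (fun c hc i x => hBbc c (by omega) t (hSI ht') i x) hAχ0 hR hAR1
      (fun c hc1 hcn x => hARk c hc1 (by omega) x)
    -- convert the left-hand side
    have hlhs : ∀ i, ∫ x, cutoff R x *
        (FluidPDE.timeDerivWithin (Icc 0 S) (fun s y => ipderiv α (fun z => u s z i - U s z i) y) t x *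
          ipderiv α (fun z => u t z i - U t z i) x) =
        ∫ x, cutoff R x *
          ((ipderiv α (fun y => ν * ∑ j, pderiv j (pderiv j fun z => u t z i) y - pderiv i (p t) y -
                ∑ j, u t y j * pderiv j (fun z => u t z i) y) x -
              ipderiv α (fun y => 0 * ∑ j, pderiv j (pderiv j fun z => U t z i) y - pderiv i (P t) y -
                ∑ j, U t y j * pderiv j (fun z => U t z i) y) x) *
            ipderiv α (fun z => u t z i - U t z i) x) := fun i =>
      integral_congr_ae (Eventually.of_forall fun x => by
        dsimp only
        rw [timeDerivWithin_ipderiv_sub_eq_rhs hu hU hS ht' x α i])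
    rw [Finset.sum_congr rfl fun i _ => hlhs i]
    refine h.trans ?_
    -- monotonicity in `n ≤ k`
    have h2n : (2 : ℝ) ^ n ≤ 2 ^ k := pow_le_pow_right₀ (by norm_num) hn
    have h2k0 : (0 : ℝ) ≤ 2 ^ k := pow_nonneg (by norm_num) k
    have hn10 : (0 : ℝ) ≤ n + 1 := add_nonneg (Nat.cast_nonneg n) zero_le_one
    have hn1 : (n : ℝ) + 1 ≤ k + 1 := by exact_mod_cast Nat.succ_le_succ hn
    have hnk : (n : ℝ) ≤ k := by exact_mod_cast hn
    have h2n1 : (2 : ℝ) ^ n * (n + 1) ≤ 2 ^ k * (k + 1) := mul_le_mul h2n hn1 hn10 h2k0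
    have h2n2 : (2 : ℝ) ^ n * (n + 1) ^ 2 ≤ 2 ^ k * (k + 1) ^ 2 :=
      mul_le_mul h2n (pow_le_pow_left₀ hn10 hn1 2) (sq_nonneg _) h2k0
    have h2nk : (2 : ℝ) ^ n * n ≤ 2 ^ k * k := mul_le_mul h2n hnk (Nat.cast_nonneg n) h2k0
    have hXn : 9 * B0u * Iws / 2 + 9 * ν * Iws + 2 ^ n * Qs * (3 * (n + 1) * Real.sqrt Iws) ≤ Xs := by
      rw [hXs]
      have h0 : 0 ≤ 3 * Qs * Real.sqrt Iws := mul_nonneg (mul_nonneg (by norm_num) hQs0) (Real.sqrt_nonneg _)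
      have : 2 ^ n * Qs * (3 * (n + 1) * Real.sqrt Iws) ≤ 2 ^ k * Qs * (3 * (k + 1) * Real.sqrt Iws) := by
        calc 2 ^ n * Qs * (3 * (n + 1) * Real.sqrt Iws) = 3 * Qs * Real.sqrt Iws * (2 ^ n * (n + 1)) := by ring
          _ ≤ 3 * Qs * Real.sqrt Iws * (2 ^ k * (k + 1)) := mul_le_mul_of_nonneg_left h2n1 h0
          _ = 2 ^ k * Qs * (3 * (k + 1) * Real.sqrt Iws) := by ring
      exact add_le_add le_rfl this
    have hT1 : Aχ * (9 * B0u * Iws / 2 + 9 * ν * Iws + 2 ^ n * Qs * (3 * (n + 1) * Real.sqrt Iws)) / R ≤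
        Aχ * Xs / R := div_le_div_of_nonneg_right (mul_le_mul_of_nonneg_left hXn hAχ0) hR0.le
    have hT3 : 2 ^ n * 9 * Bb * (n + 1) ^ 2 * Et ≤ 2 ^ k * 9 * Bb * (k + 1) ^ 2 * Et := by
      have h0 : 0 ≤ 9 * Bb * Et := mul_nonneg (mul_nonneg (by norm_num) hBb0) hEt0
      calc 2 ^ n * 9 * Bb * (n + 1) ^ 2 * Et = 9 * Bb * Et * (2 ^ n * (n + 1) ^ 2) := by ring
        _ ≤ 9 * Bb * Et * (2 ^ k * (k + 1) ^ 2) := mul_le_mul_of_nonneg_left h2n2 h0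
        _ = 2 ^ k * 9 * Bb * (k + 1) ^ 2 * Et := by ring
    have hT4 : 2 ^ n * (9 * n * (Real.sqrt Cemb * (Et * Real.sqrt Et))) ≤
        2 ^ k * (9 * k * (Real.sqrt Cemb * (Et * Real.sqrt Et))) := by
      have h0 : 0 ≤ 9 * (Real.sqrt Cemb * (Et * Real.sqrt Et)) :=
        mul_nonneg (by norm_num) (mul_nonneg (Real.sqrt_nonneg _) (mul_nonneg hEt0 (Real.sqrt_nonneg _)))
      calc 2 ^ n * (9 * n * (Real.sqrt Cemb * (Et * Real.sqrt Et)))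
          = 9 * (Real.sqrt Cemb * (Et * Real.sqrt Et)) * (2 ^ n * n) := by ring
        _ ≤ 9 * (Real.sqrt Cemb * (Et * Real.sqrt Et)) * (2 ^ k * k) := mul_le_mul_of_nonneg_left h2nk h0
        _ = 2 ^ k * (9 * k * (Real.sqrt Cemb * (Et * Real.sqrt Et))) := by ring
    linarith only [hT1, hT3, hT4]
  -- sum over the words and the levels
  have hsumα : ∀ n ≤ k, ∑ i, ∑ α : Fin n → Fin 3, ∫ x, cutoff R x *
      (FluidPDE.timeDerivWithin (Icc 0 S) (fun s y => ipderiv α (fun z => u s z i - U s z i) y) t x *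
        ipderiv α (fun z => u t z i - U t z i) x) ≤
      3 ^ k * (Aχ * Xs / R + ν * (9 * Real.sqrt IUmax) * Real.sqrt Et + 2 ^ k * 9 * Bb * (k + 1) ^ 2 * Et +
        2 ^ k * (9 * k * (Real.sqrt Cemb * (Et * Real.sqrt Et)))) := by
    intro n hn
    rw [Finset.sum_comm]
    have hpos : 0 ≤ Aχ * Xs / R + ν * (9 * Real.sqrt IUmax) * Real.sqrt Et + 2 ^ k * 9 * Bb * (k + 1) ^ 2 * Et +
        2 ^ k * (9 * k * (Real.sqrt Cemb * (Et * Real.sqrt Et))) :=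
      add_nonneg (add_nonneg (add_nonneg (div_nonneg (mul_nonneg hAχ0 hXs0) hR0.le)
        (mul_nonneg (mul_nonneg hν.le (mul_nonneg (by norm_num) (Real.sqrt_nonneg _))) (Real.sqrt_nonneg _)))
        (mul_nonneg (mul_nonneg (mul_nonneg (mul_nonneg (pow_nonneg (by norm_num) k) (by norm_num)) hBb0)
          (sq_nonneg _)) hEt0))
        (mul_nonneg (pow_nonneg (by norm_num) k) (mul_nonneg (mul_nonneg (by norm_num) (Nat.cast_nonneg k))
          (mul_nonneg (Real.sqrt_nonneg _) (mul_nonneg hEt0 (Real.sqrt_nonneg _)))))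
    calc ∑ α : Fin n → Fin 3, ∑ i, ∫ x, cutoff R x *
          (FluidPDE.timeDerivWithin (Icc 0 S) (fun s y => ipderiv α (fun z => u s z i - U s z i) y) t x *
            ipderiv α (fun z => u t z i - U t z i) x)
        ≤ ∑ _α : Fin n → Fin 3, (Aχ * Xs / R + ν * (9 * Real.sqrt IUmax) * Real.sqrt Et +
            2 ^ k * 9 * Bb * (k + 1) ^ 2 * Et + 2 ^ k * (9 * k * (Real.sqrt Cemb * (Et * Real.sqrt Et)))) :=
          Finset.sum_le_sum fun α _ => hword n hn α
      _ = 3 ^ n * _ := by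
          rw [Finset.sum_const, Finset.card_univ, Fintype.card_fun, Fintype.card_fin, Fintype.card_fin,
            nsmul_eq_mul]
          push_cast
          ring
      _ ≤ 3 ^ k * _ := mul_le_mul_of_nonneg_right (pow_le_pow_right₀ (by norm_num) hn) hpos
  have hsumn : ∑ n ∈ Finset.range (k + 1), ∑ i, ∑ α : Fin n → Fin 3, ∫ x, cutoff R x *
      (FluidPDE.timeDerivWithin (Icc 0 S) (fun s y => ipderiv α (fun z => u s z i - U s z i) y) t x *
        ipderiv α (fun z => u t z i - U t z i) x) ≤
      (k + 1) * (3 ^ k * (Aχ * Xs / R + ν * (9 * Real.sqrt IUmax) * Real.sqrt Et +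
        2 ^ k * 9 * Bb * (k + 1) ^ 2 * Et + 2 ^ k * (9 * k * (Real.sqrt Cemb * (Et * Real.sqrt Et))))) := by
    calc _ ≤ ∑ _n ∈ Finset.range (k + 1), 3 ^ k * (Aχ * Xs / R + ν * (9 * Real.sqrt IUmax) * Real.sqrt Et +
          2 ^ k * 9 * Bb * (k + 1) ^ 2 * Et + 2 ^ k * (9 * k * (Real.sqrt Cemb * (Et * Real.sqrt Et)))) :=
          Finset.sum_le_sum fun n hn => hsumα n (Nat.lt_succ_iff.1 (Finset.mem_range.1 hn))
      _ = _ := by rw [Finset.sum_const, Finset.card_range, nsmul_eq_mul]; push_cast; ring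
  -- conclude
  have hνE : 0 ≤ ν * Real.sqrt Et := mul_nonneg hν.le (Real.sqrt_nonneg _)
  have hfinal : 2 * ((k + 1) * (3 ^ k * (Aχ * Xs / R + ν * (9 * Real.sqrt IUmax) * Real.sqrt Et +
      2 ^ k * 9 * Bb * (k + 1) ^ 2 * Et + 2 ^ k * (9 * k * (Real.sqrt Cemb * (Et * Real.sqrt Et)))))) =
      (A * Et + B * (Et * Real.sqrt Et) + ν * (K' - 1) * Real.sqrt Et) + N * (Aχ * Xs) / R := by
    rw [hA, hBdef, hK', hN]
    ring
  calc 2 * ∑ n ∈ Finset.range (k + 1), ∑ i, ∑ α : Fin n → Fin 3, ∫ x, cutoff R x *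
        (FluidPDE.timeDerivWithin (Icc 0 S) (fun s y => ipderiv α (fun z => u s z i - U s z i) y) t x *
          ipderiv α (fun z => u t z i - U t z i) x)
      ≤ 2 * ((k + 1) * (3 ^ k * (Aχ * Xs / R + ν * (9 * Real.sqrt IUmax) * Real.sqrt Et +
          2 ^ k * 9 * Bb * (k + 1) ^ 2 * Et + 2 ^ k * (9 * k * (Real.sqrt Cemb * (Et * Real.sqrt Et)))))) :=
        mul_le_mul_of_nonneg_left hsumn (by norm_num)
    _ = (A * Et + B * (Et * Real.sqrt Et) + ν * (K' - 1) * Real.sqrt Et) + N * (Aχ * Xs) / R := hfinal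
    _ ≤ (A * Et + B * (Et * Real.sqrt Et) + ν * K' * Real.sqrt Et) + N * (Aχ * Xs) / R := by
        linarith only [hνE]

end Slab

/-! ## The a priori estimate and the discharge -/

section Final

/-- **Constantin's a priori estimate (1986, (1.18)), tree form.** For `m ≥ 3`, `T > 0` and a
classical Euler solution `(U, P)` on `[0, T] × ℝ³` in the Beale–Kato–Majda class there are
`ν₁ > 0` and `C` such that every Tao-class Navier–Stokes solution `u` with viscosity
`ν ∈ (0, ν₁]` from the datum `U 0` on a slab `[0, S] ⊆ [0, T]` satisfies
`∫ ‖Dⁿ(u(t) − U(t))‖² ≤ (Cν)²` for `t ∈ [0, S]`, `n ≤ m` (energy method at level `k = m + 1`,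
`exists_slice_constants` and `energy_le_of_slice`; `‖Dⁿw‖² ≤ 3ⁿ⁺¹|∇ⁿw|²`).
[cite: Constantin1986, §1 Thm. 1.1 (1.5) and (1.18)] -/
theorem constantin_apriori (m : ℕ) (hm : 3 ≤ m) (T : ℝ) (hT : 0 < T)
    (U : ℝ → EuclideanSpace ℝ (Fin 3) → EuclideanSpace ℝ (Fin 3)) (P : ℝ → EuclideanSpace ℝ (Fin 3) → ℝ)
    (hE : IsClassicalEulerSolutionOn (Icc 0 T) 0 U P) (hB : HasBoundedSobolevNormsOn (Icc 0 T) U)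
    (_hd : HasRapidSpatialDecay (U 0)) :
    ∃ ν₁ : ℝ, 0 < ν₁ ∧ ∃ C : ℝ, ∀ ν : ℝ, 0 < ν → ν ≤ ν₁ → ∀ S : ℝ, 0 < S → S ≤ T →
      ∀ (u : ℝ → EuclideanSpace ℝ (Fin 3) → EuclideanSpace ℝ (Fin 3)) (p : ℝ → EuclideanSpace ℝ (Fin 3) → ℝ),
        IsTaoSolutionOn S ν (U 0) u p →
          ∀ t ∈ Icc 0 S, ∀ n ≤ m,
            ∫⁻ x, ‖iteratedFDeriv ℝ n (u t - U t) x‖ₑ ^ 2 ≤ ENNReal.ofReal (C * ν) ^ 2 := by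
  set k : ℕ := m + 1 with hk
  have hk4 : 4 ≤ k := by omega
  obtain ⟨A, B, K', hA0, hB0, hK'0, hslab⟩ := exists_slice_constants hE hB hk4
  set K₀ : ℝ := K' ^ 2 * T ^ 2 * Real.exp (A * T + 1 / 2) with hK₀
  have hK₀0 : 0 ≤ K₀ := by rw [hK₀]; positivity
  set ν₁ : ℝ := 1 / (4 * (B * T * Real.sqrt K₀ + 1)) with hν₁
  have hden : 0 < B * T * Real.sqrt K₀ + 1 := by positivity
  have hν₁0 : 0 < ν₁ := by rw [hν₁]; positivity
  refine ⟨ν₁, hν₁0, Real.sqrt (3 ^ (k + 1) * K₀), fun ν hν hνν₁ S hS hST u p htao t ht n hn => ?_⟩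
  -- the smallness condition
  have hsmall : ν * (B * T * Real.sqrt K₀) ≤ 1 / 4 := by
    calc ν * (B * T * Real.sqrt K₀) ≤ ν₁ * (B * T * Real.sqrt K₀ + 1) :=
          mul_le_mul hνν₁ (by linarith) (by positivity) hν₁0.le
      _ = 1 / 4 := by rw [hν₁]; field_simp
  -- the slice inequality on the slab and the a priori estimate for the energy
  obtain ⟨Kerr, hKerr⟩ := hslab ν hν S hS hST u p htao.classical htao.sobolev
  have hSI : Icc 0 S ⊆ Icc 0 T := Icc_subset_Icc le_rfl hST
  have hU : IsClassicalNSSolutionOn (Icc 0 S) 0 0 U P := hE.mono hSI (uniqueDiffOn_Icc hS)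
  have hbU : HasBoundedSobolevNormsOn (Icc 0 S) U := hB.mono hSI
  have henergy := energy_le_of_slice htao.classical hU hS htao.sobolev hbU htao.initial k hA0 hB0 hK'0 hν hST
    hKerr (by rw [hK₀] at hsmall; exact hsmall) t ht
  -- from the energy to the Fréchet tensor of order `n ≤ m < k`
  have hv : ContDiff ℝ ∞ (u t - U t) := (htao.classical.contDiff_velocity ht).sub (hE.contDiff_velocity (hSI ht))
  have hL0 : ∀ m', 0 ≤ ∫ x, levelSq m' (u t - U t) x := fun m' => integral_nonneg fun x => levelSq_nonneg m' _ x
  obtain ⟨Iv, -, hIv⟩ := levelSq_sub_bounds htao.classical hU htao.sobolev hbU n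
  have hint : Integrable (levelSq n (u t - U t)) := (hIv t ht).1
  have hLn : ∫ x, levelSq n (u t - U t) x ≤ K₀ * ν ^ 2 := by
    refine le_trans ?_ (henergy.trans (le_of_eq (by rw [hK₀])))
    exact Finset.single_le_sum (f := fun n' => ∫ x, levelSq n' (u t - U t) x) (fun n' _ => hL0 n')
      (Finset.mem_range.2 (by omega))
  calc ∫⁻ x, ‖iteratedFDeriv ℝ n (u t - U t) x‖ₑ ^ 2 ≤ ENNReal.ofReal (3 ^ (n + 1) * ∫ x, levelSq n (u t - U t) x) :=
        lintegral_sq_norm_iteratedFDeriv_le hv n hint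
    _ ≤ ENNReal.ofReal ((Real.sqrt (3 ^ (k + 1) * K₀) * ν) ^ 2) := by
        refine ENNReal.ofReal_le_ofReal ?_
        rw [mul_pow, Real.sq_sqrt (by positivity)]
        have h3 : (3 : ℝ) ^ (n + 1) ≤ 3 ^ (k + 1) := pow_le_pow_right₀ (by norm_num) (by omega)
        calc 3 ^ (n + 1) * ∫ x, levelSq n (u t - U t) x ≤ 3 ^ (k + 1) * (K₀ * ν ^ 2) :=
              mul_le_mul h3 hLn (hL0 n) (by positivity)
          _ = 3 ^ (k + 1) * K₀ * ν ^ 2 := by ring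
    _ = ENNReal.ofReal (Real.sqrt (3 ^ (k + 1) * K₀) * ν) ^ 2 := by
        rw [ENNReal.ofReal_pow (by positivity)]

/-- **Constantin 1986, Thm. 1.1 — discharge of `constantin_small_viscosity`.** As long as the
Euler solution from a rapidly decaying datum is smooth on `[0, T]` (classical, all Sobolev
norms bounded), the Navier–Stokes solutions with the same datum and small viscosity
`0 < ν ≤ ν₀` exist as classical solutions on `[0, T]` in the same class, and
`∫‖Dⁿ(u(t) − U(t))‖² ≤ (Cν)²` for `n ≤ m` (Constantin's (1.5)). Proof: the a priori estimate
`constantin_apriori` (energy inequality (1.10) + Lemma 1.3) and the continuation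
`constantin_small_viscosity_of_apriori` (restart in Tao's class). [cite: Constantin1986, §1 Thm. 1.1] -/
theorem constantin_small_viscosity_holds : constantin_small_viscosity :=
  constantin_small_viscosity_of_apriori constantin_apriori

end Final

end Literature.Analysis.FluidPDE

end
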